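import Literature.Analysis.FluidPDE.CKNMorreyLocalEnergy
import HarnessLib

/-!
# Lemarié-Rieusset 2016, §13.9, Step 2: finiteness and real form of the local estimates

Analysis/FluidPDE file in the decomposition of the named fact
`Literature.Analysis.FluidPDE.lemarieRieusset_ckn_criterion` (Lemarié-Rieusset 2016, Thm. 13.8),
towards `LemarieRieusset2016.lemma13_4` from `LemarieRieusset2016.lemma13_3`: the bookkeeping
that turns the `[0, ∞]`-valued estimates (13.30)–(13.31) into inequalities between real numbers
(p. 471: "We introduce the reduced quantities …"). Everything here is **proved**.

* Finiteness of the quantities of §13.9 on cylinders inside the domain, under the standing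
  hypotheses `LemarieRieusset2016.IsSuitableOn` (p. 466: "`U_r(t,x)` and `V_r(t,x)` are well
  defined … `F_r` … `P_r` is well defined"): `energyU_le_of_subset`, `gradV_lt_top_of_subset`,
  `pressureP_lt_top_of_subset`, and the force bound `forceF_le_of_morrey` from
  `1_Ω f ∈ ℳ₂^{10/7,τ₀}` ((13.36), p. 471).
* `lemma13_3_real` — (13.30)–(13.31) for the real numbers `U_r.toReal`, … (same shape).

## References

* P. G. Lemarié-Rieusset, *The Navier–Stokes Problem in the 21st Century*, CRC Press (2016),
  §13.9, p. 466, Lemma 13.3 (p. 470), (13.36) and the reduced quantities (p. 471). [LemarieRieusset2016]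
-/

noncomputable section

open MeasureTheory Set Function Filter Topology TopologicalSpace Metric
open scoped NNReal ENNReal InnerProductSpace RealInnerProductSpace Laplacian

namespace Literature.Analysis.FluidPDE

namespace LemarieRieusset2016

/-! ### Finiteness of `U_r, V_r, P_r, F_r` on cylinders inside `Ω` -/

/-- `U_r(z) ≤ C` whenever `Q_r(z) ⊆ Ω` and `∫_{Ω_t} |u|² ≤ C` for a.e. `t` (the energy class
`u ∈ L^∞_t L²_x(Ω)`; Lemarié-Rieusset 2016, p. 466: "`U_r(t,x)` … well defined"). [folklore] -/
theorem energyU_le_of_subset {Ω : Set (ℝ × EuclideanSpace ℝ (Fin 3))}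
    {u : ℝ → EuclideanSpace ℝ (Fin 3) → EuclideanSpace ℝ (Fin 3)} {C : ℝ≥0} {r : ℝ}
    {z : ℝ × EuclideanSpace ℝ (Fin 3)}
    (hE : ∀ᵐ t : ℝ,
      ∫⁻ x, Ω.indicator (fun w : ℝ × EuclideanSpace ℝ (Fin 3) => ‖u w.1 w.2‖ₑ ^ 2) (t, x) ≤ C)
    (hsub : FluidPDE.parabolicCylinderCentered r z ⊆ Ω) : energyU u r z ≤ C := by
  rw [energyU]
  refine essSup_le_of_ae_le (C : ℝ≥0∞) ?_
  rw [Filter.EventuallyLE, ae_restrict_iff' measurableSet_Ioo]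
  filter_upwards [hE] with s hs hsI
  refine le_trans ?_ hs
  rw [← lintegral_indicator measurableSet_ball]
  refine lintegral_mono fun y => ?_
  by_cases hy : y ∈ ball z.2 r
  · have hmem : (s, y) ∈ Ω := hsub (mk_mem_prod hsI hy)
    rw [indicator_of_mem hy, indicator_of_mem hmem]
  · rw [indicator_of_notMem hy]
    exact bot_le

/-- `V_r(z) < ∞` whenever `Q_r(z) ⊆ Ω` and `∫∫_Ω |∇ ⊗ u|² < ∞`. [folklore] -/
theorem gradV_lt_top_of_subset {Ω : Set (ℝ × EuclideanSpace ℝ (Fin 3))}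
    {G : ℝ → EuclideanSpace ℝ (Fin 3) → EuclideanSpace ℝ (Fin 3) →L[ℝ] EuclideanSpace ℝ (Fin 3)}
    {r : ℝ} {z : ℝ × EuclideanSpace ℝ (Fin 3)}
    (hG : ∫⁻ w in Ω, ENNReal.ofReal (FluidPDE.frobeniusNormSq (G w.1 w.2)) < ∞)
    (hsub : FluidPDE.parabolicCylinderCentered r z ⊆ Ω) : gradV G r z < ∞ :=
  (lintegral_mono_set hsub).trans_lt hG

/-- `P_r(z) < ∞` whenever `Q_r(z) ⊆ Ω` and `∫∫_Ω |p|^{q₀} < ∞`. [folklore] -/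
theorem pressureP_lt_top_of_subset {Ω : Set (ℝ × EuclideanSpace ℝ (Fin 3))}
    {p : ℝ → EuclideanSpace ℝ (Fin 3) → ℝ} {q₀ r : ℝ} {z : ℝ × EuclideanSpace ℝ (Fin 3)}
    (hp : ∫⁻ w in Ω, ‖p w.1 w.2‖ₑ ^ q₀ < ∞)
    (hsub : FluidPDE.parabolicCylinderCentered r z ⊆ Ω) : pressureP p q₀ r z < ∞ :=
  (lintegral_mono_set hsub).trans_lt hp

/-- **(13.36)**: `F_r(z) ≤ ‖1_Ω f‖ r^{5(1 - 10/(7τ₀))}` whenever `Q_r(z) ⊆ Ω` and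
`1_Ω f ∈ ℳ₂^{10/7,τ₀}` with constant `M` (Lemarié-Rieusset 2016, (13.36), p. 471). [cite: LemarieRieusset2016, (13.36) p. 471] -/
theorem forceF_le_of_morrey {Ω : Set (ℝ × EuclideanSpace ℝ (Fin 3))}
    {f : ℝ → EuclideanSpace ℝ (Fin 3) → EuclideanSpace ℝ (Fin 3)} {τ₀ : ℝ} {M : ℝ≥0} {r : ℝ}
    {z : ℝ × EuclideanSpace ℝ (Fin 3)}
    (hM : ∀ (z' : ℝ × EuclideanSpace ℝ (Fin 3)) (r' : ℝ), 0 < r' →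
      ∫⁻ w in FluidPDE.parabolicCylinderCentered r' z' ∩ Ω, (fun w => ‖f w.1 w.2‖ₑ) w ^ (10 / 7 : ℝ) ≤
        M * ENNReal.ofReal (r' ^ (5 * (1 - 10 / 7 / τ₀))))
    (hr : 0 < r) (hsub : FluidPDE.parabolicCylinderCentered r z ⊆ Ω) :
    forceF f r z ≤ M * ENNReal.ofReal (r ^ (5 * (1 - 10 / 7 / τ₀))) := by
  have := hM z r hr
  rwa [inter_eq_self_of_subset_left hsub] at this

/-! ### Lemma 13.3 in real form -/

/-- **(13.30)–(13.31) between real numbers.** If the quantities at scale `ρ` are finite (as they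
are on cylinders inside `Ω`), the `[0, ∞]`-valued estimates (13.30)–(13.31) of Lemma 13.3 give
the same inequalities for `U.toReal, V.toReal, P.toReal, F.toReal` (and force finiteness at
scale `r`). Pure bookkeeping (`ENNReal.toReal` is monotone and multiplicative on finite values). [folklore] -/
theorem lemma13_3_real {C : ℝ≥0} {q₀ r ρ : ℝ} {Ur Vr Pr Uρ Vρ Pρ Fρ : ℝ≥0∞} (hq₀ : 0 < q₀)
    (hr : 0 < r) (hρ : 0 < ρ) (hUρ : Uρ ≠ ∞) (hVρ : Vρ ≠ ∞) (hPρ : Pρ ≠ ∞) (hFρ : Fρ ≠ ∞)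
    (h30 : Ur + Vr ≤
      C * (ENNReal.ofReal ((r / ρ) ^ 3) * Uρ +
        ENNReal.ofReal (ρ ^ (1 / 2 : ℝ) / r) * (Uρ + Vρ) * Vρ ^ (1 / 2 : ℝ) +
        ENNReal.ofReal (r⁻¹ * ρ ^ (2 + 3 / 2 - 5 / q₀)) * Pρ ^ (1 / q₀) * Uρ ^ (1 / 2 : ℝ) +
        (Uρ + Vρ) ^ (1 / 2 : ℝ) * Fρ ^ (7 / 10 : ℝ)))
    (h31 : Pr ≤ C * (ENNReal.ofReal ((r / ρ) ^ 3) * Pρ +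
      ENNReal.ofReal (r ^ (5 * (1 - 2 * q₀ / 3)) * ρ ^ (q₀ / 3)) * Uρ ^ (q₀ / 2) * Vρ ^ (q₀ / 2))) :
    Ur ≠ ∞ ∧ Vr ≠ ∞ ∧ Pr ≠ ∞ ∧
    Ur.toReal + Vr.toReal ≤
      C * ((r / ρ) ^ 3 * Uρ.toReal +
        ρ ^ (1 / 2 : ℝ) / r * (Uρ.toReal + Vρ.toReal) * Vρ.toReal ^ (1 / 2 : ℝ) +
        r⁻¹ * ρ ^ (2 + 3 / 2 - 5 / q₀) * Pρ.toReal ^ (1 / q₀) * Uρ.toReal ^ (1 / 2 : ℝ) +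
        (Uρ.toReal + Vρ.toReal) ^ (1 / 2 : ℝ) * Fρ.toReal ^ (7 / 10 : ℝ)) ∧
    Pr.toReal ≤ C * ((r / ρ) ^ 3 * Pρ.toReal +
      r ^ (5 * (1 - 2 * q₀ / 3)) * ρ ^ (q₀ / 3) * Uρ.toReal ^ (q₀ / 2) * Vρ.toReal ^ (q₀ / 2)) := by
  have hq' : 0 ≤ 1 / q₀ := by positivity
  have hUV : Uρ + Vρ ≠ ∞ := ENNReal.add_ne_top.2 ⟨hUρ, hVρ⟩
  have hx1 : 0 ≤ (r / ρ) ^ 3 := by positivity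
  have hx2 : 0 ≤ ρ ^ (1 / 2 : ℝ) / r := by positivity
  have hx3 : 0 ≤ r⁻¹ * ρ ^ (2 + 3 / 2 - 5 / q₀) := by positivity
  have hx4 : 0 ≤ r ^ (5 * (1 - 2 * q₀ / 3)) * ρ ^ (q₀ / 3) := by positivity
  -- finiteness of the four terms of (13.30) and the two terms of (13.31)
  have hT1 : ENNReal.ofReal ((r / ρ) ^ 3) * Uρ ≠ ∞ := ENNReal.mul_ne_top ENNReal.ofReal_ne_top hUρ
  have hT2 : ENNReal.ofReal (ρ ^ (1 / 2 : ℝ) / r) * (Uρ + Vρ) * Vρ ^ (1 / 2 : ℝ) ≠ ∞ :=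
    ENNReal.mul_ne_top (ENNReal.mul_ne_top ENNReal.ofReal_ne_top hUV)
      (ENNReal.rpow_ne_top_of_nonneg (by norm_num) hVρ)
  have hT3 : ENNReal.ofReal (r⁻¹ * ρ ^ (2 + 3 / 2 - 5 / q₀)) * Pρ ^ (1 / q₀) * Uρ ^ (1 / 2 : ℝ) ≠ ∞ :=
    ENNReal.mul_ne_top (ENNReal.mul_ne_top ENNReal.ofReal_ne_top
      (ENNReal.rpow_ne_top_of_nonneg hq' hPρ)) (ENNReal.rpow_ne_top_of_nonneg (by norm_num) hUρ)
  have hT4 : (Uρ + Vρ) ^ (1 / 2 : ℝ) * Fρ ^ (7 / 10 : ℝ) ≠ ∞ :=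
    ENNReal.mul_ne_top (ENNReal.rpow_ne_top_of_nonneg (by norm_num) hUV)
      (ENNReal.rpow_ne_top_of_nonneg (by norm_num) hFρ)
  have hT12 : ENNReal.ofReal ((r / ρ) ^ 3) * Uρ +
      ENNReal.ofReal (ρ ^ (1 / 2 : ℝ) / r) * (Uρ + Vρ) * Vρ ^ (1 / 2 : ℝ) ≠ ∞ :=
    ENNReal.add_ne_top.2 ⟨hT1, hT2⟩
  have hT123 : ENNReal.ofReal ((r / ρ) ^ 3) * Uρ +
      ENNReal.ofReal (ρ ^ (1 / 2 : ℝ) / r) * (Uρ + Vρ) * Vρ ^ (1 / 2 : ℝ) +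
      ENNReal.ofReal (r⁻¹ * ρ ^ (2 + 3 / 2 - 5 / q₀)) * Pρ ^ (1 / q₀) * Uρ ^ (1 / 2 : ℝ) ≠ ∞ :=
    ENNReal.add_ne_top.2 ⟨hT12, hT3⟩
  have hR30 : C * (ENNReal.ofReal ((r / ρ) ^ 3) * Uρ +
        ENNReal.ofReal (ρ ^ (1 / 2 : ℝ) / r) * (Uρ + Vρ) * Vρ ^ (1 / 2 : ℝ) +
        ENNReal.ofReal (r⁻¹ * ρ ^ (2 + 3 / 2 - 5 / q₀)) * Pρ ^ (1 / q₀) * Uρ ^ (1 / 2 : ℝ) +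
        (Uρ + Vρ) ^ (1 / 2 : ℝ) * Fρ ^ (7 / 10 : ℝ)) ≠ ∞ :=
    ENNReal.mul_ne_top ENNReal.coe_ne_top (ENNReal.add_ne_top.2 ⟨hT123, hT4⟩)
  have hS1 : ENNReal.ofReal ((r / ρ) ^ 3) * Pρ ≠ ∞ := ENNReal.mul_ne_top ENNReal.ofReal_ne_top hPρ
  have hS2 : ENNReal.ofReal (r ^ (5 * (1 - 2 * q₀ / 3)) * ρ ^ (q₀ / 3)) * Uρ ^ (q₀ / 2) *
      Vρ ^ (q₀ / 2) ≠ ∞ :=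
    ENNReal.mul_ne_top (ENNReal.mul_ne_top ENNReal.ofReal_ne_top
      (ENNReal.rpow_ne_top_of_nonneg (by positivity) hUρ))
      (ENNReal.rpow_ne_top_of_nonneg (by positivity) hVρ)
  have hR31 : C * (ENNReal.ofReal ((r / ρ) ^ 3) * Pρ +
      ENNReal.ofReal (r ^ (5 * (1 - 2 * q₀ / 3)) * ρ ^ (q₀ / 3)) * Uρ ^ (q₀ / 2) * Vρ ^ (q₀ / 2)) ≠
      ∞ :=
    ENNReal.mul_ne_top ENNReal.coe_ne_top (ENNReal.add_ne_top.2 ⟨hS1, hS2⟩)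
  have hsum : Ur + Vr ≠ ∞ := ne_top_of_le_ne_top hR30 h30
  obtain ⟨hUr, hVr⟩ := ENNReal.add_ne_top.1 hsum
  have hPr : Pr ≠ ∞ := ne_top_of_le_ne_top hR31 h31
  refine ⟨hUr, hVr, hPr, ?_, ?_⟩
  · have := ENNReal.toReal_mono hR30 h30
    rw [ENNReal.toReal_add hUr hVr, ENNReal.toReal_mul, ENNReal.toReal_add hT123 hT4,
      ENNReal.toReal_add hT12 hT3, ENNReal.toReal_add hT1 hT2] at this
    simpa only [ENNReal.toReal_mul, ← ENNReal.toReal_rpow, ENNReal.toReal_add hUρ hVρ,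
      ENNReal.coe_toReal, ENNReal.toReal_ofReal hx1, ENNReal.toReal_ofReal hx2,
      ENNReal.toReal_ofReal hx3] using this
  · have := ENNReal.toReal_mono hR31 h31
    rw [ENNReal.toReal_mul, ENNReal.toReal_add hS1 hS2] at this
    simpa only [ENNReal.toReal_mul, ← ENNReal.toReal_rpow, ENNReal.coe_toReal,
      ENNReal.toReal_ofReal hx1, ENNReal.toReal_ofReal hx4] using this

end LemarieRieusset2016

end Literature.Analysis.FluidPDE
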